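import Summits.QuantumFields.BalabanUV.T4Continuum.Support.NE3DiscreteGradientEstimate
import Summits.QuantumFields.BalabanUV.T4Continuum.Spine.NE3.LandauCorrectionSupB8FlatUnit
import HarnessLib

/-!
# T⁴ programme, node NE3 — census R37 (file 3∕3): (H0) AT THE FLAT DATUM FOR EVERY `(L, N, j)` — sup-regularity of `Δ_1` on B8's test space `N(Q′(1))`,
# `‖u‖_∞ ≤ 16d³·M²·‖Δ_1u‖_∞`, `‖D_1u‖_∞ ≤ 16d²·M·‖Δ_1u‖_∞` (`M = L^{j+1}`), UNIFORM IN `j` AND IN THE TORUS SIZE `N`; hence the END's sup letter `hK`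
# (`LandauCorrectionSupB8`) at `W = 1` holds UNCONDITIONALLY on the unit torus, and on every torus from (HR) alone

Cell `pub-balaban-gaps` (YM blitz, track G2, seat `ne3`, unit `pub-balaban-gaps-ne3-g8`; writer prover-pub-balaban-gaps-ne3-g8-0, 2026-08-24), census
`run/shared/lean/pub/pub-balaban-gaps/ne/NE3.md` §4 R37, §14.  WHY.  Gen 7 (`LandauCorrectionSupB8Flat`, `…FlatUnit`, `PairLandauB8EndSupFacts`) displayed the
[B9] content of the END's hypothesis `hK` as two sup-norm facts per background, (H0_W) and (HR_W), and found both kernel-checked in the Literature at `U = 1`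
only on carrier families that miss the cell's headline `L = 2` and every small `N` (finding F12; (H0) recorded as «[3]-type, NOT elementary in d = 4»).
THIS FILE discharges (H0) at `U = 1` on the tree's OWN carrier for EVERY `L ≥ 1`, `N ≥ 1`, `j`, `d`, by the lattice maximum principle of files 1∕3–2∕3
(`NE3LatticeGradientBarrier`, `NE3DiscreteGradientEstimate`: the discrete Gilbarg–Trudinger interior gradient estimate + the block-mean bootstrap):

* §1 dictionaries at the flat background: `covLapSite 1 u y = −Σ_μ ((u(y+e_μ) − u y) − (u y − u(y−e_μ)))` (`covLapSite_flatCfg_eq_neg_laplacian`), and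
  `u ∈ avgKernelGauges L N (j+1) 1 ⟹` every `M`-block sum of `u` vanishes (`blockSum_eq_zero_of_mem_avgKernelGauges`; `bmeanIterW_one`, `iterate_bmean_apply`).
* §2 **`supRegularity_flatCfg`** — (H0) AT THE FLAT DATUM: for `L ≥ 1`, `N ≥ 1`, `j`, `u ∈ avgKernelGauges L N (j+1) flatCfg` and `‖covLapSite flatCfg u‖_∞ ≤ B`:
  `‖u(y)‖ ≤ 16d³·(L^{j+1})²·B` and `‖gaugeDir flatCfg u (y, μ)‖ ≤ 16d²·L^{j+1}·B` — EXACTLY the binder `hG` of `landauCorrectionSupB8_flatCfg_of_supFacts` with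
  `c₀ = 16d³`, `c₁ = 16d²`, for every `(L, N, j)` at once (k-UNIFORM, N-UNIFORM).
* §3 **`landauCorrectionSupB8_flatCfg_unit`** — `LandauCorrectionSupB8 hL j hWu hx hs hWx 1 hθ (12d·liftC·16d³) (12d·liftC·16d²)`: the END's `hK` at `W = 1` on the
  UNIT torus for every `L ≥ 2`, `j` — UNCONDITIONAL (R35 supplied (HR) there with `c_R = 2`); and **`landauCorrectionSupB8_flatCfg_of_projectionSup`** — on EVERY
  torus `N ≥ 1`, `hK` at `W = 1` ⇐ (HR) ALONE (`K₀ = 6d·liftC·16d³·c_R`, `K₁ = 6d·liftC·16d²·c_R`).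

So of the two [B9]-§3 facts behind `hK`, the `G′`-type one ((2.67)∕(3.42) e0∕e1) is ELEMENTARY at the flat datum on every torus; what remains of the flat `hK` for
`N ≥ 2` is ONLY (HR) = the `ℓ^∞` bound of B8's projection `R(1)` onto `Δ_1N(Q′(1))` ((3.25)∕(3.49) TYPE).  R36's float constants (`K₀ ≈ 3.7`, `K₁ ≈ 11` at
`d = 4`, `N = 1`) sit far inside `12d·liftC·16d³`.

CONTENT (0 sorry; no `def`; [folklore]).  HONEST FRAMING.  A statement at the TRIVIAL background `W = 1`: (H0_W)∕(HR_W) at the curved backgrounds `W = cavg L U_B`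
of the pairs, `hK` over `sfClass`, (P♮) at curved `W`, `PairLandauGaugeB8Avg`, the covariant root and **NE3 are NOT proved**; (HR) at `U = 1` for `N ≥ 2` is NOT
proved; spine PROVED 0∕9; finite T⁴ rung (B)+1 — NOT infinite volume, NOT mass gap, NOT `BetaPertH`, NOT Clay.  PLACEMENT: `Summits/QuantumFields/BalabanUV/
T4Continuum/Spine/NE3/`; imports accepted modules only; moves nothing.  HONEST DEPENDENCY (cell page 1): continuum YM on T⁴ ⇐ BetaPertH ∧ nine spine estimates
(0/9 proved); BetaPertH ⇐ (D1) ∧ (D4) ∧ CAP+tail; G-an2-4 gates asym, D1 and NE2/3/4.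
-/

set_option autoImplicit false

open scoped BigOperators Matrix Matrix.Norms.L2Operator
open NormedSpace Finset

namespace Summit.QuantumFields.BalabanUV.T4Continuum.NE3.LandauCorrectionSupB8FlatH0

open Literature.MathematicalPhysics.QuantumFieldTheory.Balaban1983to89
open B7Prop1Explicit B7Prop2Explicit
open T4AveragingDeficitWall (IsUnitaryCfg IsSkewDir SmallField)
open T4AveragingDeficitWallBoundary (IsPeriodicCfg periodBox card_periodBox)
open AveragingDeficitMultiLevelPrep (LevelSmall)
open BlockAveragePushDirGauge (gaugeDir)
open MinimalActionWitness (flatCfg isPeriodicCfg_flatCfg)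
open NE3QbarIterCovLiftPrep (cruxC liftC)
open NE3CovariantCalculus (hsR)
open NE3CovariantWeitzenbock (covDiv covDiv_flatCfg)
open NE3CovariantBlockMean (bmeanIterW)
open NE3NestedBlockMeanCovariance (bmeanIterW_one)
open NE3FramePotGauge (bmean iterate_bmean_apply)
open NE3TangentNoGoWords (dPot)
open NE3FrameFreeSliceUnique (gaugeDir_flatCfg_eq_neg_dPot)
open NE3.PairLandauB8 (avgKernelGauges covLapSite)
open NE3.LandauProjectionB8 (covDiv_gaugeDir_eq_covLapSite)
open NE3.LandauProjectionSupShape (LandauCorrectionSupB8)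
open NE3.SlicePoincareSlicB8Flat (flatCfg_eq_one)
open NE3.LandauCorrectionSupB8Flat (landauCorrectionSupB8_flatCfg_of_supFacts)
open NE3.LandauCorrectionSupB8FlatUnit (landauCorrectionSupB8_flatCfg_unit_of_supRegularity)
open NE3DiscreteGradientEstimate (supRegularity_of_blockMeanZero)

noncomputable section

variable {d : ℕ} {n : Type*} [Fintype n] [DecidableEq n]

/-! ## §1 Flat dictionaries: the site Laplacian and the block sums of B8's test space -/

/-- **THE FLAT SITE LAPLACIAN IS MINUS THE LATTICE LAPLACIAN**: `covLapSite 1 u y = −Σ_μ ((u(y+e_μ) − u y) − (u y − u(y−e_μ)))` (`Δ_1 = covDiv_1 ∘ D_1`,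
`D_1 = −dPot`). [folklore] -/
theorem covLapSite_flatCfg_eq_neg_laplacian (u : Site d → Matrix n n ℂ) (y : Site d) :
    covLapSite (flatCfg (d := d) (n := n)) u y = -∑ μ : Fin d, ((u (y + e μ) - u y) - (u y - u (y - e μ))) := by
  rw [← congrFun (covDiv_gaugeDir_eq_covLapSite (flatCfg (d := d) (n := n)) u) y, covDiv_flatCfg, ← Finset.sum_neg_distrib]
  refine Finset.sum_congr rfl fun μ _ => ?_
  rw [gaugeDir_flatCfg_eq_neg_dPot, gaugeDir_flatCfg_eq_neg_dPot]
  simp only [dPot, sub_add_cancel]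
  abel

/-- The norm of the flat site Laplacian is the norm of the lattice Laplacian. [folklore] -/
theorem norm_covLapSite_flatCfg (u : Site d → Matrix n n ℂ) (y : Site d) :
    ‖covLapSite (flatCfg (d := d) (n := n)) u y‖ = ‖∑ μ : Fin d, ((u (y + e μ) - u y) - (u y - u (y - e μ)))‖ := by
  rw [covLapSite_flatCfg_eq_neg_laplacian, norm_neg]

/-- **MEMBERS OF `N(Q′(1))` HAVE VANISHING `M`-BLOCK SUMS** (`M = L^{j+1}`, `L ≥ 1`): at the flat background the nested transported block mean is the plain
`M`-block mean (`bmeanIterW_one`, `iterate_bmean_apply`). [folklore] -/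
theorem blockSum_eq_zero_of_mem_avgKernelGauges {L N : ℕ} (hL : 1 ≤ L) (j : ℕ) {u : Site d → Matrix n n ℂ}
    (hu : u ∈ avgKernelGauges (d := d) (n := n) L N (j + 1) (flatCfg (d := d) (n := n))) (z : Site d) :
    ∑ v ∈ periodBox (d := d) (L ^ (j + 1)), u (((L ^ (j + 1) : ℕ) : ℤ) • z + v) = 0 := by
  obtain ⟨-, -, hmean⟩ := hu
  have h := congrFun hmean z
  rw [flatCfg_eq_one, bmeanIterW_one, iterate_bmean_apply hL (j + 1) u z] at h
  have hc : ((((L ^ (j + 1) : ℕ) : ℝ) ^ d)⁻¹ : ℝ) ≠ 0 := by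
    have hL0 : (0 : ℝ) < ((L ^ (j + 1) : ℕ) : ℝ) := by exact_mod_cast Nat.pow_pos (n := j + 1) hL
    positivity
  exact (smul_eq_zero.mp h).resolve_left hc

/-! ## §2 (H0) at the flat datum for every `(L, N, j)` -/

/-- **(H0) AT THE FLAT DATUM — SUP-REGULARITY OF `Δ_1` ON `N(Q′(1))`, UNIFORM IN THE LEVEL AND IN THE TORUS SIZE**: for `L ≥ 1`, `N ≥ 1`, `j` and
`u ∈ avgKernelGauges L N (j+1) flatCfg` (skew, `(N·L^{j+1})`-periodic, nested block means zero) with `‖covLapSite flatCfg u y‖ ≤ B` for all `y`: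
`‖u y‖ ≤ 16d³·(L^{j+1})²·B` and `‖gaugeDir flatCfg u y μ‖ ≤ 16d²·L^{j+1}·B` for all `y`, `μ` — the binder `hG` of `landauCorrectionSupB8_flatCfg_of_supFacts`
with `c₀ = 16d³`, `c₁ = 16d²` ([Balaban1984PropagatorsII] (2.67) e0∕e1 at `U = 1` read on `Δ_1N(Q′(1))`, here PROVED by the lattice maximum principle). [folklore] -/
theorem supRegularity_flatCfg {L N : ℕ} (hL : 1 ≤ L) (hN : 1 ≤ N) (j : ℕ) {u : Site d → Matrix n n ℂ}
    (hu : u ∈ avgKernelGauges (d := d) (n := n) L N (j + 1) (flatCfg (d := d) (n := n))) {B : ℝ}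
    (hB : ∀ y : Site d, ‖covLapSite (flatCfg (d := d) (n := n)) u y‖ ≤ B) :
    (∀ y : Site d, ‖u y‖ ≤ 16 * (d : ℝ) ^ 3 * ((L : ℝ) ^ (j + 1)) ^ 2 * B) ∧
      (∀ (y : Site d) (μ : Fin d), ‖gaugeDir (flatCfg (d := d) (n := n)) u y μ‖ ≤ 16 * (d : ℝ) ^ 2 * (L : ℝ) ^ (j + 1) * B) := by
  have hM : 1 ≤ L ^ (j + 1) := Nat.one_le_pow _ _ hL
  have hMr : ((L ^ (j + 1) : ℕ) : ℝ) = (L : ℝ) ^ (j + 1) := by push_cast; ring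
  have hmean := blockSum_eq_zero_of_mem_avgKernelGauges hL j hu
  obtain ⟨-, huP, -⟩ := hu
  have hB' : ∀ y : Site d, ‖∑ μ : Fin d, ((u (y + e μ) - u y) - (u y - u (y - e μ)))‖ ≤ B := fun y => by
    rw [← norm_covLapSite_flatCfg]; exact hB y
  rcases Nat.eq_zero_or_pos d with hd | hd
  · -- `d = 0`: the lattice is one point and the block sum is the value
    subst hd
    have hcard : (periodBox (d := 0) (L ^ (j + 1))).card = 1 := by rw [card_periodBox, pow_zero]
    obtain ⟨v, hv⟩ := Finset.card_eq_one.mp hcard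
    have h0 := hmean 0
    rw [hv, Finset.sum_singleton] at h0
    have hu0 : ∀ y : Site 0, u y = 0 := fun y => by
      rw [Subsingleton.elim y ((((L ^ (j + 1) : ℕ) : ℤ)) • (0 : Site 0) + v)]; exact h0
    refine ⟨fun y => ?_, fun y μ => μ.elim0⟩
    rw [hu0 y, norm_zero]
    simp
  · have h := supRegularity_of_blockMeanZero (E := Matrix n n ℂ) hd hM hN u huP hmean hB'
    refine ⟨fun y => ?_, fun y μ => ?_⟩
    · have h2 := h.2 y
      rw [hMr] at h2
      exact h2
    · have h1 := h.1 y μ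
      rw [hMr] at h1
      rw [gaugeDir_flatCfg_eq_neg_dPot, norm_neg]
      exact h1

/-! ## §3 The flat-datum `hK`: unconditional on the unit torus; from (HR) alone on every torus -/

/-- **THE END's SUP LETTER `hK` AT `W = 1` ON THE UNIT TORUS — UNCONDITIONAL** (every `d`, `L ≥ 2`, `j`; `N = 1`, `M = L^{j+1}`):
`LandauCorrectionSupB8 hL j hWu hx hs hWx 1 hθ (12d·liftC·16d³) (12d·liftC·16d²)` — gen 7's `landauCorrectionSupB8_flatCfg_unit_of_supRegularity` ((HR) at `N = 1`
is elementary, `c_R = 2`) with its ONLY hypothesis (H0) now supplied by §2.  The first discharge of a [B9]-§3-TYPE hypothesis shape of THE END at a datum, with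
constants independent of `j`. [folklore] -/
theorem landauCorrectionSupB8_flatCfg_unit [Nonempty n] {L : ℕ} (hL : 2 ≤ L) (j : ℕ) {x : ℝ}
    (hWu : IsUnitaryCfg (flatCfg (d := d) (n := n))) (hx : 0 ≤ x) (hs : LevelSmall d L j x) (hWx : SmallField (flatCfg (d := d) (n := n)) x)
    (hθ : cruxC d L * (((L : ℝ) ^ (j + 1)) ^ 2 * x) < 1) :
    LandauCorrectionSupB8 hL j hWu hx hs hWx 1 hθ (12 * (d : ℝ) * liftC d * (16 * (d : ℝ) ^ 3)) (12 * (d : ℝ) * liftC d * (16 * (d : ℝ) ^ 2)) :=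
  landauCorrectionSupB8_flatCfg_unit_of_supRegularity hL j hWu hx hs hWx hθ
    (fun _ hu _ hB => supRegularity_flatCfg (by omega) le_rfl j hu hB)

/-- **THE END's SUP LETTER `hK` AT `W = 1` ON EVERY TORUS FROM (HR) ALONE** (every `d`, `L ≥ 2`, `N ≥ 1`, `j`): gen 7's `landauCorrectionSupB8_flatCfg_of_supFacts`
with (H0) supplied by §2 — `LandauCorrectionSupB8` at `W = 1` with `K₀ = 6d·liftC·16d³·c_R`, `K₁ = 6d·liftC·16d²·c_R` ⇐ (HR): the `ℓ^∞ → ℓ^∞` bound `c_R` of B8's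
(1.38)-projection `R(1)` onto `Δ_1N(Q′(1))` in solution form ([Balaban1985BackgroundPropagators] (3.25)∕(3.49) at `U = 1`, TYPE, NOT proved here). [folklore] -/
theorem landauCorrectionSupB8_flatCfg_of_projectionSup [Nonempty n] {L : ℕ} (hL : 2 ≤ L) (j : ℕ) {x : ℝ}
    (hWu : IsUnitaryCfg (flatCfg (d := d) (n := n))) (hx : 0 ≤ x) (hs : LevelSmall d L j x) (hWx : SmallField (flatCfg (d := d) (n := n)) x)
    (N : ℕ) [NeZero N] (hθ : cruxC d L * (((L : ℝ) ^ (j + 1)) ^ 2 * x) < 1) {cR : ℝ}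
    (hR : ∀ (F : Site d → Matrix n n ℂ), (∀ y : Site d, F y ∈ skewAdjoint (Matrix n n ℂ)) →
      (∀ (y : Site d) (i : Fin d), F (y + ((N * L ^ (j + 1) : ℕ) : ℤ) • e i) = F y) →
      ∀ μ ∈ avgKernelGauges (d := d) (n := n) L N (j + 1) (flatCfg (d := d) (n := n)),
        (∀ ν ∈ avgKernelGauges (d := d) (n := n) L N (j + 1) (flatCfg (d := d) (n := n)),
          ∑ y ∈ periodBox (d := d) (N * L ^ (j + 1)),
            hsR (F y + covLapSite (flatCfg (d := d) (n := n)) μ y) (covLapSite (flatCfg (d := d) (n := n)) ν y) = 0) →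
        ∀ B : ℝ, (∀ y : Site d, ‖F y‖ ≤ B) → ∀ y : Site d, ‖covLapSite (flatCfg (d := d) (n := n)) μ y‖ ≤ cR * B) :
    LandauCorrectionSupB8 hL j hWu hx hs hWx N hθ (6 * (d : ℝ) * liftC d * (16 * (d : ℝ) ^ 3) * cR) (6 * (d : ℝ) * liftC d * (16 * (d : ℝ) ^ 2) * cR) :=
  landauCorrectionSupB8_flatCfg_of_supFacts hL j hWu hx hs hWx N hθ
    (fun _ hu _ hB => supRegularity_flatCfg (by omega) (Nat.one_le_iff_ne_zero.mpr (NeZero.ne N)) j hu hB) hR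

end

end Summit.QuantumFields.BalabanUV.T4Continuum.NE3.LandauCorrectionSupB8FlatH0
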